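import Summits.QuantumFields.YangMills.Theorems.UnitScaleTiltProp7CovCombMeanFrames
import Summits.QuantumFields.YangMills.Theorems.UnitScaleTiltProp7CovBlockPoincareCentred
import HarnessLib

/-!
# Route `UnitScaleTilt`, crux K1 «MinimiserStabilityRegPr» (stmt-QuantumFields-19200), route-R [RP] at a curved background — THE CURVED N6,
# ROW (R-B), PART 4b: THE PER-LEVEL TERM OF THE COARSE GAUGE FUNCTION IN `ℓ²` —
# `Σ_z ‖CM_j(X)(z)‖² ≤ (d+2)²N·L⁴·‖∇^{(j)}X‖²_{ℓ²} + 4(d+2)²d³(3N+2d)·L⁶a_j²·‖X‖²_{ℓ²}`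

Cell `ym3-torus`, D-0154 (3c) R3 twin-width seat `ym-routeR-w2` (W-SEAT MAP pass #3 row M9: «(R-B) instantiation»; architecture «ℓ²-Minkowski over levels,
level-local», ★★OWNER g26 ACK 12).  Fifth file of the (R-B) chain: ✓ `…CovCombMeanCentred` (centring, abstract frames), ✓ `…CovBlockPoincareCentred`
(oscillation around the transported block mean), ✓ `…CovIterLambdaBound` (propagation + tower junction), `…CovCombMeanFrames` (dictionary, corner-frame defect,
centring with pre-transport, block bonds).  THEOREMS ONLY (0 `def`, 0 `sorry`); `--supports stmt-QuantumFields-19200`, count-neutral.  YM₃ on T³ is a ladder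
rung (R3), not the Clay problem; nothing here claims the curved N6 bound, S2, P, the crux or the gap.

THE STEP.  For the recursion of record `Λ_{j+1}(z) = CM_j(G_j)(z) + Λ_j(emb z)` (✓ p606268), `Prop7CovIterLambdaBound.sqrt_sum_normSq_le_sum_levels` needs the `ℓ²`
size of the per-level term `t_j(z) = ‖CM_j(G_j)(z)‖`.  Per block: centring (`norm_covCombMean_le_osc_frame`, corner comb frame pre-transported to the centre,
frame defect `θ = (dL)²a`) with the oscillation `o` read off the mean-subtracted comb-gauge block Poincaré inequality (`normSq_conj_sub_mean_le_sum`, block side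
`L`) and `B² = Σ_{B(z)}‖X‖²`; then `(o + 2θB)² ≤ 2o² + 8θ²B²`; summed over the blocks the interior gradient energies are at most the full covariant gradient
energy and the masses add up to `‖X‖²_{ℓ²}`.
* ★ `normSq_covCombMean_le_block` — `‖CM_j(X)(z)‖² ≤ (d+2)²N·L⁴·GX(z) + 4(d+2)²d³(3N+2d)·L⁶a²·SX(z)`.
* ★★ `sum_normSq_covCombMean_le` — `Σ_z ‖CM_j(X)(z)‖² ≤ (d+2)²N·L⁴·Σ_bΣ_ν‖V(b₋,ν)X(b+e_ν)V(b₋,ν)* − X(b)‖² + 4(d+2)²d³(3N+2d)·L⁶a²·Σ_b‖X(b)‖²`, uniformly in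
  the volume and the level — `‖t_j‖²_{ℓ²} ≤ C₁‖∇^{(j)}X‖² + C₂a_j²‖X‖²`.
HONEST SCOPE.  One level; the one-step gradient transfer `‖∇^{(j+1)}LINE_j X‖ ≤ L^{(4−d)/2}‖∇^{(j)}X‖ + …` and the final `hΛ` assembly are the next files.

References: T. Bałaban, CMP 95 (1984) 17–40 [Balaban1984PropagatorsI] ((1.18)–(1.20) pp.19–20); CMP 89 (1983) 571–597 [Balaban1983RegularityDecay] ((2.27) p.580);
CMP 98 (1985) 17–51 [Balaban1985Averaging] ((62) p.28).
-/

noncomputable section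

open scoped BigOperators Matrix.Norms.L2Operator

namespace Summit.QuantumFields.YangMills.Theorems.Prop7CovCombMeanPoincare

open Literature.MathematicalPhysics.QuantumFieldTheory.Balaban1983to89
open Finset T4Continuum BlockAveraging AveragingRT BlockAveragingEMLLinearised BlockAveragingEMLLinearisedBackground B1RG242Torus
open B7Prop1Explicit (treeWord plaqWord U1)
open B7Eq78Linearization (conjR conjR_apply)
open B10Eq27TorusAxialLog (holT unitsField toUField)
open Beta.CoordCubePoincare (stepUp)
open B5Leaf237C0Torus (bsite bsite_stepUp sum_bsite)
open Summit.QuantumFields.YangMills.Theorems.Prop7CovariantCoercivity (hyp_of_specialUnitary)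
open Summit.QuantumFields.YangMills.Theorems.Prop7CovBlockPoincareCentred (normSq_conj_sub_mean_le_sum)
open Summit.QuantumFields.YangMills.Theorems.Prop7CovCombMeanFrames (conjR_holT_su conjR_bond_su sitesPerDir_eq predL_succ intOffset_bsite
  frame_defect_corner_le norm_covCombMean_le_osc_frame exists_offset_of_blockOf)

variable {N : ℕ} [NeZero N] {P : Params} {j : ℕ}

/-! ## §5 ★ The per-level term, per block and summed over the blocks -/

/-- `(L − 1) + 1 = L` in `ℝ`. [folklore] -/
theorem cast_predL_add_one : (((P.L - 1 : ℕ) : ℝ)) + 1 = (P.L : ℝ) := by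
  exact_mod_cast Nat.sub_add_cancel P.L_pos

/-- The real arithmetic of the per-block assembly: `t ≤ ℓ(o + 2θB)`, `o² ≤ pG + qS`, `B² = S` ⇒ `t² ≤ 2ℓ²p·G + (2ℓ²q + 8ℓ²θ²)·S`. [folklore] -/
theorem sq_le_of_centring {t o θ B ℓ p q G S : ℝ} (ht0 : 0 ≤ t) (ht : t ≤ ℓ * (o + 2 * θ * B)) (ho2 : o ^ 2 ≤ p * G + q * S)
    (hB2 : B ^ 2 = S) :
    t ^ 2 ≤ 2 * ℓ ^ 2 * p * G + (2 * ℓ ^ 2 * q + 8 * ℓ ^ 2 * θ ^ 2) * S := by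
  have h1 : t ^ 2 ≤ (ℓ * (o + 2 * θ * B)) ^ 2 := pow_le_pow_left₀ ht0 ht 2
  have h2 : (o + 2 * θ * B) ^ 2 ≤ 2 * o ^ 2 + 8 * (θ ^ 2 * B ^ 2) := by nlinarith [sq_nonneg (o - 2 * θ * B)]
  have h3 : (ℓ * (o + 2 * θ * B)) ^ 2 ≤ ℓ ^ 2 * (2 * o ^ 2 + 8 * (θ ^ 2 * B ^ 2)) := by
    rw [mul_pow]; exact mul_le_mul_of_nonneg_left h2 (by positivity)
  have h4 : ℓ ^ 2 * (2 * o ^ 2 + 8 * (θ ^ 2 * B ^ 2)) ≤ ℓ ^ 2 * (2 * (p * G + q * S) + 8 * (θ ^ 2 * S)) := by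
    rw [hB2]; refine mul_le_mul_of_nonneg_left ?_ (by positivity); linarith
  calc t ^ 2 ≤ ℓ ^ 2 * (2 * (p * G + q * S) + 8 * (θ ^ 2 * S)) := h1.trans (h3.trans h4)
    _ = _ := by ring

set_option maxHeartbeats 400000 in
/-- ★ **THE PER-LEVEL TERM OF THE COARSE GAUGE FUNCTION, PER BLOCK**: for an `SU(N)` background `V` of `T^{(j)}` with plaquette variables within `a` of `1` and any
bond field `X`, the covariant comb mean over `B(z)` obeys
`‖CM_j(X)(z)‖² ≤ (d+2)²N·L⁴·Σ_{μ,ν}Σ_{r_ν<L−1} ‖R(V(x_r,ν))X(x_{r+e_ν},μ) − X(x_r,μ)‖² + 4(d+2)²d³(3N+2d)·L⁶a²·Σ_{μ,r} ‖X(x_r,μ)‖²`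
(centring with the corner comb frame pre-transported to the centre, oscillation from the mean-subtracted comb-gauge block Poincaré inequality, frame defect
`(dL)²a`, `(o + 2θB)² ≤ 2o² + 8θ²B²`; the gradient is written in the engine's `R(·)` letters, `conjR_bond_su` reads it in `SU(N)` letters).
[cite: Balaban1984PropagatorsI, (1.18) p.20; Balaban1983RegularityDecay, (2.27) p.580; Balaban1985Averaging, (62) p.28] -/
theorem normSq_covCombMean_le_block (hj : j + 1 ≤ P.m + P.K) (V : GaugeField P j (Matrix.specialUnitaryGroup (Fin N) ℂ)) {a : ℝ} (ha : 0 ≤ a)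
    (hV : ∀ q : Plaq P j, dist1 (GaugeField.plaqHol V q) ≤ a) (X : PBond P j → Matrix (Fin N) (Fin N) ℂ) (z : Site P (j + 1)) :
    ‖((Fintype.card (Idx P) : ℂ))⁻¹ • ∑ i : Idx P, covWalkSum V X (walk (emb z) (stairWord i.2.1 (off i.1)))‖ ^ 2
      ≤ ((P.d : ℝ) + 2) ^ 2 * N * (P.L : ℝ) ^ 4 *
          ∑ μ : Fin P.d, ∑ ν : Fin P.d, ∑ r ∈ univ.filter (fun r : Fin P.d → Fin (P.L - 1 + 1) => r ν ≠ Fin.last (P.L - 1)),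
            ‖conjR (unitsField (toUField V) ⟨bsite P j 1 predL_succ z r, ν⟩) (X ⟨bsite P j 1 predL_succ z (stepUp r ν), μ⟩) - X ⟨bsite P j 1 predL_succ z r, μ⟩‖ ^ 2
        + 4 * ((P.d : ℝ) + 2) ^ 2 * (P.d : ℝ) ^ 3 * (3 * N + 2 * P.d) * (P.L : ℝ) ^ 6 * a ^ 2 *
          ∑ μ : Fin P.d, ∑ r : Fin P.d → Fin (P.L - 1 + 1), ‖X ⟨bsite P j 1 predL_succ z r, μ⟩‖ ^ 2 := by
  obtain ⟨hV', hplaq⟩ := hyp_of_specialUnitary V hV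
  have h := sitesPerDir_eq hj
  have hn1 : (((P.L - 1 : ℕ) : ℝ)) + 1 = (P.L : ℝ) := cast_predL_add_one
  -- opaque names for the two block functionals (no rewriting of the goal until the very end)
  obtain ⟨GX, hGX⟩ : ∃ GX : ℝ, GX = ∑ μ : Fin P.d, ∑ ν : Fin P.d, ∑ r ∈ univ.filter (fun r : Fin P.d → Fin (P.L - 1 + 1) => r ν ≠ Fin.last (P.L - 1)),
      ‖conjR (unitsField (toUField V) ⟨bsite P j 1 predL_succ z r, ν⟩) (X ⟨bsite P j 1 predL_succ z (stepUp r ν), μ⟩) - X ⟨bsite P j 1 predL_succ z r, μ⟩‖ ^ 2 :=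
    ⟨_, rfl⟩
  obtain ⟨SX, hSX⟩ : ∃ SX : ℝ, SX = ∑ μ : Fin P.d, ∑ r : Fin P.d → Fin (P.L - 1 + 1), ‖X ⟨bsite P j 1 predL_succ z r, μ⟩‖ ^ 2 := ⟨_, rfl⟩
  have hGX0 : 0 ≤ GX := by
    rw [hGX]; exact Finset.sum_nonneg fun _ _ => Finset.sum_nonneg fun _ _ => Finset.sum_nonneg fun _ _ => sq_nonneg _
  have hSX0 : 0 ≤ SX := by rw [hSX]; exact Finset.sum_nonneg fun _ _ => Finset.sum_nonneg fun _ _ => sq_nonneg _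
  -- the per-component Poincaré right-hand sides and their sum
  obtain ⟨R, hR⟩ : ∃ R : Fin P.d → ℝ, R = fun μ => (N / 2) * (P.L : ℝ) ^ 2 *
      ∑ ν : Fin P.d, ∑ r ∈ univ.filter (fun r : Fin P.d → Fin (P.L - 1 + 1) => r ν ≠ Fin.last (P.L - 1)),
        ‖conjR (unitsField (toUField V) ⟨bsite P j 1 predL_succ z r, ν⟩) (X ⟨bsite P j 1 predL_succ z (stepUp r ν), μ⟩) - X ⟨bsite P j 1 predL_succ z r, μ⟩‖ ^ 2
      + 6 * N * (P.d : ℝ) ^ 3 * (((P.L - 1 : ℕ) : ℝ)) ^ 2 * (P.L : ℝ) ^ 2 * a ^ 2 *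
        ∑ r : Fin P.d → Fin (P.L - 1 + 1), ‖X ⟨bsite P j 1 predL_succ z r, μ⟩‖ ^ 2 := ⟨_, rfl⟩
  have hR0 : ∀ μ, 0 ≤ R μ := fun μ => by
    rw [hR]
    have h1 : 0 ≤ ∑ ν : Fin P.d, ∑ r ∈ univ.filter (fun r : Fin P.d → Fin (P.L - 1 + 1) => r ν ≠ Fin.last (P.L - 1)),
        ‖conjR (unitsField (toUField V) ⟨bsite P j 1 predL_succ z r, ν⟩) (X ⟨bsite P j 1 predL_succ z (stepUp r ν), μ⟩) - X ⟨bsite P j 1 predL_succ z r, μ⟩‖ ^ 2 :=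
      Finset.sum_nonneg fun _ _ => Finset.sum_nonneg fun _ _ => sq_nonneg _
    have h2 : 0 ≤ ∑ r : Fin P.d → Fin (P.L - 1 + 1), ‖X ⟨bsite P j 1 predL_succ z r, μ⟩‖ ^ 2 := Finset.sum_nonneg fun _ _ => sq_nonneg _
    have h3 : (0 : ℝ) ≤ N / 2 * (P.L : ℝ) ^ 2 := by positivity
    have h4 : (0 : ℝ) ≤ 6 * N * (P.d : ℝ) ^ 3 * (((P.L - 1 : ℕ) : ℝ)) ^ 2 * (P.L : ℝ) ^ 2 * a ^ 2 := by positivity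
    exact add_nonneg (mul_nonneg h3 h1) (mul_nonneg h4 h2)
  have hRsum : ∑ μ : Fin P.d, R μ = (N / 2) * (P.L : ℝ) ^ 2 * GX + 6 * N * (P.d : ℝ) ^ 3 * (((P.L - 1 : ℕ) : ℝ)) ^ 2 * (P.L : ℝ) ^ 2 * a ^ 2 * SX := by
    rw [hGX, hSX, Finset.mul_sum, Finset.mul_sum, ← Finset.sum_add_distrib]
    exact Finset.sum_congr rfl fun μ _ => by rw [hR]
  -- frames and constants
  obtain ⟨ybar, hybar⟩ : ∃ ybar : Site P j, ybar = bsite P j 1 predL_succ z fun _ => 0 := ⟨_, rfl⟩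
  obtain ⟨τ, hτ⟩ : ∃ τ : Site P j → Matrix.specialUnitaryGroup (Fin N) ℂ,
      τ = fun y => holAt V (walk ybar (treeWord fun ν => ((y ν).val : ℤ) - ((ybar ν).val : ℤ))) := ⟨_, rfl⟩
  obtain ⟨W, hW⟩ : ∃ W : Matrix.specialUnitaryGroup (Fin N) ℂ,
      W = holAt V (walk ybar (treeWord fun ν => (((emb z) ν).val : ℤ) - ((ybar ν).val : ℤ))) := ⟨_, rfl⟩
  obtain ⟨m, hm⟩ : ∃ m : Fin P.d → Matrix (Fin N) (Fin N) ℂ, m = fun μ => (((P.L : ℝ)) ^ P.d)⁻¹ •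
      ∑ r' : Fin P.d → Fin (P.L - 1 + 1), conjR (holT (unitsField (toUField V)) ybar (treeWord fun ν => ((r' ν : ℕ) : ℤ))) (X ⟨bsite P j 1 predL_succ z r', μ⟩) :=
    ⟨_, rfl⟩
  obtain ⟨o, ho⟩ : ∃ o : ℝ, o = Real.sqrt (∑ μ : Fin P.d, R μ) := ⟨_, rfl⟩
  obtain ⟨B, hB⟩ : ∃ B : ℝ, B = Real.sqrt SX := ⟨_, rfl⟩
  obtain ⟨θ, hθ⟩ : ∃ θ : ℝ, θ = (((P.d * P.L : ℕ) : ℝ)) ^ 2 * a := ⟨_, rfl⟩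
  have ho0 : 0 ≤ o := by rw [ho]; exact Real.sqrt_nonneg _
  have hB0 : 0 ≤ B := by rw [hB]; exact Real.sqrt_nonneg _
  have hθ0 : 0 ≤ θ := by rw [hθ]; positivity
  -- (hBz): each bond variable on the block is below the block mass
  have hBz : ∀ b : PBond P j, blockOf b.src = z → blockOf b.tgt = z → ‖X b‖ ≤ B := by
    intro b hs ht
    obtain ⟨r, hr, -⟩ := exists_offset_of_blockOf hj z b hs ht
    have hb : b = ⟨bsite P j 1 predL_succ z r, b.dir⟩ := by cases b; simp only at hr; rw [hr]
    rw [hB, ← Real.sqrt_sq (norm_nonneg (X b))]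
    refine Real.sqrt_le_sqrt ?_
    rw [hb, hSX]
    refine le_trans ?_ (Finset.single_le_sum (f := fun μ => ∑ r : Fin P.d → Fin (P.L - 1 + 1), ‖X ⟨bsite P j 1 predL_succ z r, μ⟩‖ ^ 2)
      (fun μ _ => Finset.sum_nonneg fun _ _ => sq_nonneg _) (Finset.mem_univ b.dir))
    exact Finset.single_le_sum (f := fun r => ‖X ⟨bsite P j 1 predL_succ z r, b.dir⟩‖ ^ 2) (fun r _ => sq_nonneg _) (Finset.mem_univ r)
  -- (hosc): the oscillation around the transported block means, from the mean-subtracted comb-gauge Poincaré inequality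
  have hosc : ∀ b : PBond P j, blockOf b.src = z → blockOf b.tgt = z →
      ‖((τ b.src : Matrix.specialUnitaryGroup (Fin N) ℂ) : Matrix (Fin N) (Fin N) ℂ) * X b *
          star ((τ b.src : Matrix.specialUnitaryGroup (Fin N) ℂ) : Matrix (Fin N) (Fin N) ℂ) - m b.dir‖ ≤ o := by
    intro b hs ht
    obtain ⟨r, hr, -⟩ := exists_offset_of_blockOf hj z b hs ht
    have hb : b = ⟨bsite P j 1 predL_succ z r, b.dir⟩ := by cases b; simp only at hr; rw [hr]
    have hτr : τ b.src = holAt V (walk ybar (treeWord fun ν => ((r ν : ℕ) : ℤ))) := by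
      rw [hτ, ← hr]; simp only []; rw [hybar, intOffset_bsite hj z r]
    have hP := normSq_conj_sub_mean_le_sum hV' ha hplaq h predL_succ z (fun r => X ⟨bsite P j 1 predL_succ z r, b.dir⟩) r
    rw [← hybar, conjR_holT_su, hn1] at hP
    have hsq : ‖((τ b.src : Matrix.specialUnitaryGroup (Fin N) ℂ) : Matrix (Fin N) (Fin N) ℂ) * X b *
          star ((τ b.src : Matrix.specialUnitaryGroup (Fin N) ℂ) : Matrix (Fin N) (Fin N) ℂ) - m b.dir‖ ^ 2 ≤ R b.dir := by
      refine le_trans (le_of_eq ?_) (le_of_le_of_eq hP ?_)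
      · rw [hτr, hm, hb]
      · rw [hR]
    rw [ho, ← Real.sqrt_sq (norm_nonneg _)]
    exact Real.sqrt_le_sqrt (hsq.trans (Finset.single_le_sum (f := R) (fun μ _ => hR0 μ) (Finset.mem_univ b.dir)))
  -- (hframe): the corner comb frame seen from the centre
  have hframe : ∀ (σ : Equiv.Perm (Fin P.d)) (r : Fin P.d → Fin P.L) (p : ℕ), p ≤ (stairWord σ (off r)).length →
      ‖((W * holAt V (walk (emb z) ((stairWord σ (off r)).take p)) : Matrix.specialUnitaryGroup (Fin N) ℂ) : Matrix (Fin N) (Fin N) ℂ) *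
          star ((τ (walkEnd (emb z) ((stairWord σ (off r)).take p)) : Matrix.specialUnitaryGroup (Fin N) ℂ) : Matrix (Fin N) (Fin N) ℂ) - 1‖ ≤ θ := by
    intro σ r p _
    rw [hW, hτ, hybar, hθ]
    exact frame_defect_corner_le hj V ha hV z σ r p
  -- centring, then the arithmetic
  have hcm := norm_covCombMean_le_osc_frame hj V X m z τ W ho0 hθ0 hB0 hBz hosc hframe
  have hpred : (((P.L - 1 : ℕ) : ℝ)) ^ 2 ≤ (P.L : ℝ) ^ 2 := by
    have : (((P.L - 1 : ℕ) : ℝ)) ≤ P.L := by rw [← hn1]; linarith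
    exact pow_le_pow_left₀ (Nat.cast_nonneg _) this 2
  have ho2 : o ^ 2 ≤ ((N / 2) * (P.L : ℝ) ^ 2) * GX + (6 * N * (P.d : ℝ) ^ 3 * (P.L : ℝ) ^ 2 * (P.L : ℝ) ^ 2 * a ^ 2) * SX := by
    rw [ho, Real.sq_sqrt (Finset.sum_nonneg fun μ _ => hR0 μ), hRsum]
    have h0 : 0 ≤ 6 * N * (P.d : ℝ) ^ 3 := by positivity
    have h1 : 0 ≤ (P.L : ℝ) ^ 2 * a ^ 2 * SX := by positivity
    nlinarith [mul_le_mul_of_nonneg_left hpred h0]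
  have hB2 : B ^ 2 = SX := by rw [hB, Real.sq_sqrt hSX0]
  have hmain := sq_le_of_centring (norm_nonneg _) hcm ho2 hB2
  have hfin : ‖((Fintype.card (Idx P) : ℂ))⁻¹ • ∑ i : Idx P, covWalkSum V X (walk (emb z) (stairWord i.2.1 (off i.1)))‖ ^ 2
      ≤ ((P.d : ℝ) + 2) ^ 2 * N * (P.L : ℝ) ^ 4 * GX + 4 * ((P.d : ℝ) + 2) ^ 2 * (P.d : ℝ) ^ 3 * (3 * N + 2 * P.d) * (P.L : ℝ) ^ 6 * a ^ 2 * SX := by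
    refine hmain.trans (le_of_eq ?_)
    rw [hθ]; push_cast; ring
  rw [hGX, hSX] at hfin
  exact hfin

/-- Interior offset pairs are among all bond pairs: summing the interior energies of the blocks gives at most the full energy. [folklore] -/
theorem sum_blocks_interior_le (hj : j + 1 ≤ P.m + P.K) (g : Site P j → Fin P.d → ℝ) (hg : ∀ x ν, 0 ≤ g x ν) :
    ∑ z : Site P (j + 1), ∑ ν : Fin P.d, ∑ r ∈ univ.filter (fun r : Fin P.d → Fin (P.L - 1 + 1) => r ν ≠ Fin.last (P.L - 1)),
        g (bsite P j 1 predL_succ z r) ν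
      ≤ ∑ x : Site P j, ∑ ν : Fin P.d, g x ν := by
  rw [sum_bsite P (sitesPerDir_eq hj) predL_succ (fun x => ∑ ν : Fin P.d, g x ν)]
  refine Finset.sum_le_sum fun z _ => ?_
  calc ∑ ν : Fin P.d, ∑ r ∈ univ.filter (fun r : Fin P.d → Fin (P.L - 1 + 1) => r ν ≠ Fin.last (P.L - 1)), g (bsite P j 1 predL_succ z r) ν
      ≤ ∑ ν : Fin P.d, ∑ r : Fin P.d → Fin (P.L - 1 + 1), g (bsite P j 1 predL_succ z r) ν :=
        Finset.sum_le_sum fun ν _ => Finset.sum_le_sum_of_subset_of_nonneg (Finset.filter_subset _ _) fun r _ _ => hg _ _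
    _ = ∑ r : Fin P.d → Fin (P.L - 1 + 1), ∑ ν : Fin P.d, g (bsite P j 1 predL_succ z r) ν := Finset.sum_comm

/-- ★★ **THE `ℓ²` SIZE OF THE PER-LEVEL TERM OF THE COARSE GAUGE FUNCTION** (the input `‖t_j‖_{ℓ²}` of `Prop7CovIterLambdaBound.sqrt_sum_normSq_le_sum_levels` for
the recursion of record `Λ_{j+1}(z) = CM_j(G_j)(z) + Λ_j(emb z)`): for an `SU(N)` background `V` of `T^{(j)}` with plaquette variables within `a` of `1`,
`Σ_z ‖CM_j(X)(z)‖² ≤ (d+2)²N·L⁴·Σ_b Σ_ν ‖V(b₋,ν)X(b+e_ν)V(b₋,ν)* − X(b)‖² + 4(d+2)²d³(3N+2d)·L⁶a²·Σ_b ‖X(b)‖²` — uniformly in the volume and the level.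
[cite: Balaban1984PropagatorsI, (1.18)-(1.20) pp.19-20; Balaban1983RegularityDecay, (2.27) p.580] -/
theorem sum_normSq_covCombMean_le (hj : j + 1 ≤ P.m + P.K) (V : GaugeField P j (Matrix.specialUnitaryGroup (Fin N) ℂ)) {a : ℝ} (ha : 0 ≤ a)
    (hV : ∀ q : Plaq P j, dist1 (GaugeField.plaqHol V q) ≤ a) (X : PBond P j → Matrix (Fin N) (Fin N) ℂ) :
    ∑ z : Site P (j + 1), ‖((Fintype.card (Idx P) : ℂ))⁻¹ • ∑ i : Idx P, covWalkSum V X (walk (emb z) (stairWord i.2.1 (off i.1)))‖ ^ 2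
      ≤ ((P.d : ℝ) + 2) ^ 2 * N * (P.L : ℝ) ^ 4 *
          ∑ b : PBond P j, ∑ ν : Fin P.d,
            ‖((V ⟨b.src, ν⟩ : Matrix.specialUnitaryGroup (Fin N) ℂ) : Matrix (Fin N) (Fin N) ℂ) * X ⟨b.src.shift ν, b.dir⟩
                * star ((V ⟨b.src, ν⟩ : Matrix.specialUnitaryGroup (Fin N) ℂ) : Matrix (Fin N) (Fin N) ℂ) - X b‖ ^ 2
        + 4 * ((P.d : ℝ) + 2) ^ 2 * (P.d : ℝ) ^ 3 * (3 * N + 2 * P.d) * (P.L : ℝ) ^ 6 * a ^ 2 * ∑ b : PBond P j, ‖X b‖ ^ 2 := by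
  have h := sitesPerDir_eq hj
  refine (Finset.sum_le_sum fun z _ => normSq_covCombMean_le_block hj V ha hV X z).trans ?_
  rw [Finset.sum_add_distrib, ← Finset.mul_sum, ← Finset.mul_sum]
  -- the mass term is the full `ℓ²` norm
  have hS : ∑ z : Site P (j + 1), ∑ μ : Fin P.d, ∑ r : Fin P.d → Fin (P.L - 1 + 1), ‖X ⟨bsite P j 1 predL_succ z r, μ⟩‖ ^ 2
      = ∑ b : PBond P j, ‖X b‖ ^ 2 := by
    rw [B10StarCount.sum_pbond (fun b : PBond P j => ‖X b‖ ^ 2), sum_bsite P h predL_succ (fun x => ∑ μ : Fin P.d, ‖X ⟨x, μ⟩‖ ^ 2)]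
    exact Finset.sum_congr rfl fun z _ => Finset.sum_comm
  -- the interior gradient energies are at most the full gradient energy (engine letters, then `SU(N)` letters)
  set g : Site P j → Fin P.d → ℝ := fun x ν => ∑ μ : Fin P.d,
      ‖((V ⟨x, ν⟩ : Matrix.specialUnitaryGroup (Fin N) ℂ) : Matrix (Fin N) (Fin N) ℂ) * X ⟨x.shift ν, μ⟩
          * star ((V ⟨x, ν⟩ : Matrix.specialUnitaryGroup (Fin N) ℂ) : Matrix (Fin N) (Fin N) ℂ) - X ⟨x, μ⟩‖ ^ 2 with hgdef
  have hg0 : ∀ x ν, 0 ≤ g x ν := fun x ν => by rw [hgdef]; exact Finset.sum_nonneg fun _ _ => sq_nonneg _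
  have hG : ∑ z : Site P (j + 1), ∑ μ : Fin P.d, ∑ ν : Fin P.d, ∑ r ∈ univ.filter (fun r : Fin P.d → Fin (P.L - 1 + 1) => r ν ≠ Fin.last (P.L - 1)),
        ‖conjR (unitsField (toUField V) ⟨bsite P j 1 predL_succ z r, ν⟩) (X ⟨bsite P j 1 predL_succ z (stepUp r ν), μ⟩) - X ⟨bsite P j 1 predL_succ z r, μ⟩‖ ^ 2
      ≤ ∑ b : PBond P j, ∑ ν : Fin P.d,
          ‖((V ⟨b.src, ν⟩ : Matrix.specialUnitaryGroup (Fin N) ℂ) : Matrix (Fin N) (Fin N) ℂ) * X ⟨b.src.shift ν, b.dir⟩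
              * star ((V ⟨b.src, ν⟩ : Matrix.specialUnitaryGroup (Fin N) ℂ) : Matrix (Fin N) (Fin N) ℂ) - X b‖ ^ 2 := by
    -- rewrite each block's interior energy through `g`
    have hblk : ∀ z : Site P (j + 1),
        ∑ μ : Fin P.d, ∑ ν : Fin P.d, ∑ r ∈ univ.filter (fun r : Fin P.d → Fin (P.L - 1 + 1) => r ν ≠ Fin.last (P.L - 1)),
          ‖conjR (unitsField (toUField V) ⟨bsite P j 1 predL_succ z r, ν⟩) (X ⟨bsite P j 1 predL_succ z (stepUp r ν), μ⟩) - X ⟨bsite P j 1 predL_succ z r, μ⟩‖ ^ 2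
        = ∑ ν : Fin P.d, ∑ r ∈ univ.filter (fun r : Fin P.d → Fin (P.L - 1 + 1) => r ν ≠ Fin.last (P.L - 1)), g (bsite P j 1 predL_succ z r) ν := by
      intro z
      rw [Finset.sum_comm]
      refine Finset.sum_congr rfl fun ν _ => ?_
      rw [Finset.sum_comm]
      refine Finset.sum_congr rfl fun r hr => Finset.sum_congr rfl fun μ _ => ?_
      rw [conjR_bond_su, bsite_stepUp P predL_succ z r ν (Finset.mem_filter.mp hr).2]
    rw [Finset.sum_congr rfl fun z _ => hblk z]
    refine (sum_blocks_interior_le hj g hg0).trans (le_of_eq ?_)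
    rw [B10StarCount.sum_pbond (fun b : PBond P j => ∑ ν : Fin P.d,
      ‖((V ⟨b.src, ν⟩ : Matrix.specialUnitaryGroup (Fin N) ℂ) : Matrix (Fin N) (Fin N) ℂ) * X ⟨b.src.shift ν, b.dir⟩
          * star ((V ⟨b.src, ν⟩ : Matrix.specialUnitaryGroup (Fin N) ℂ) : Matrix (Fin N) (Fin N) ℂ) - X b‖ ^ 2)]
    exact Finset.sum_congr rfl fun x _ => Finset.sum_comm
  rw [hS]
  have hc1 : 0 ≤ ((P.d : ℝ) + 2) ^ 2 * N * (P.L : ℝ) ^ 4 := by positivity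
  linarith [mul_le_mul_of_nonneg_left hG hc1]

end Summit.QuantumFields.YangMills.Theorems.Prop7CovCombMeanPoincare

end
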